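/-
Origin: expansion seat `planner-pub-hodgecm-pohl-g8-0`, handover #2 2026-08-18T07:27:08Z (`HOME/pub-hodgecm-pohl-g8/lean/Pohl8/DegreeZeroIffDescent.lean`, md5 558b7441, 97 lines);
landed by the gen-7 packager in gate run 26 as `HodgeCM/Proofs/Pohlmann/DegreeZeroIffDescent.lean` (import ^import Pohl8\.→import HodgeCM.Proofs.Pohlmann. ×1).
-/
/-
Copyright: pub-hodgecm formalisation cell (harness21, 2026). New file (not vendored).
Origin: HOME/pub-hodgecm-pohl-g8/lean/Pohl8/DegreeZeroIffDescent.lean — session planner-pub-hodgecm-pohl-g8-0 (unit pub-hodgecm-pohl-g8),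
EXPANSION part (b) `PohlmannSpan`, generation 8.  Intended final place: `HodgeCM/Proofs/Pohlmann/DegreeZeroIffDescent.lean`
(module `HodgeCM.Proofs.Pohlmann.DegreeZeroIffDescent`).  ADDITIVE leaf; land AFTER this seat's
`HodgeCM.Proofs.Pohlmann.DegreeZeroIff` (RUN 26 HANDOVER #1) and after the RUN-25 files `HodgeCM.Proofs.Pohlmann.DegreeZeroDescent`,
`HodgeCM.Proofs.Pohlmann.UnitH0Connected` (qw8b-g3) and `HodgeCM.Model.Toy.KillH0` (pohl-g7); replaces nothing; nothing imports it.
Import rewrite: `import Pohl8.DegreeZeroIff` ↦ `import HodgeCM.Proofs.Pohlmann.DegreeZeroIff`.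
-/
import Summits.HodgeConjecture.HodgeCM.Proofs.Pohlmann.DegreeZeroIff
import Summits.HodgeConjecture.HodgeCM.Proofs.Pohlmann.DegreeZeroDescent
import Summits.HodgeConjecture.HodgeCM.Proofs.Pohlmann.UnitH0Connected
import Summits.HodgeConjecture.HodgeCM.Model.Toy.KillH0

/-!
# The degree-`0` equivalence over the binder list OF RECORD (runs 24/25)

`DegreeZeroIff` (this seat) proves `PohlmannTheorem31All ↔ CMProdConnectedGalois` over `ModelAxioms` + N1–N4 and reads it over
pohl-g6's trace cone.  This leaf restates the reading over the generic list the package actually assembles over since run 24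
(`Assembly.COR_CM_of_descentFacts`: `ModelAxioms`, N1–N4, `Fact_dimProd` (M40), F7d `Fact_gysinDescent`), using qw8b-g3's
`finrank_coh_zero_cmProd_le_one_of_descent` (`dim_ℚ H⁰(A′) ≤ 1` over that list, run 25):

* `pohlmannTheorem31All_iff_nontrivial_of_descent` — over `ModelAxioms` + N1–N4 + `Fact_dimProd` + F7d, Gao–Ullmo Thm 3.1 for
  every `p ≥ 0` ⟺ `H⁰(∏_{j ≤ n} A_{(F,Θ_j)}, ℚ) ≠ 0` for every Galois CM field `F` [corpus:paper:arxiv-2411.12249 p0009 L32–L39];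
* `cmProdConnectedGalois_of_unitH0` — qw8-g4's F-H0 `Fact_unitH0` gives the right-hand side of `pohlmannTheorem31All_iff`
  (through qw8b-g3's `cmProdConnected_of_unitH0`), so `pohlmannTheorem31All_of_unitH0` factors through the iff;
* `cmProdConnectedGalois_independent` — pohl-g7's counter-universe read through the iff: `CMProdConnectedGalois` (equivalently,
  given M + N1–N4, `PohlmannTheorem31All`) is NOT derivable from `ModelAxioms` + N1–N4 + F4 + F5 + F7d + `Fact_dimProd`
  (`Toy.degreeZero_independent`), while it IS implied by each of `CMProdConnected`, M42 `Fact_H0_rank`, F6, F-H0.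

KERNEL over tree files; nothing cited; no new `Fact_`; no statement named after PerL / [QW8] / 2001.
-/

noncomputable section

namespace HodgeCM

namespace Universe

open Literature.AlgebraicGeometry.Motives (CMType)

variable {U : Universe}

/-- **Over the run-24/25 generic list** (`ModelAxioms`, N1–N4, `Fact_dimProd`, F7d), under which `dim_ℚ H⁰(A′) ≤ 1`
(qw8b-g3 `finrank_coh_zero_cmProd_le_one_of_descent`): Thm 3.1 for all `p ≥ 0` ⟺ `H⁰(A′) ≠ 0` for every Galois CM product. -/
theorem pohlmannTheorem31All_iff_nontrivial_of_descent (M : U.ModelAxioms) (hN1 : U.Fact_cupExterior)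
    (hN2 : U.Fact_cup_hodge) (hN3 : U.Fact_pull_H0) (hN4 : U.Fact_hodge_F0) (hd : U.Fact_dimProd)
    (h7d : U.Fact_gysinDescent) :
    U.PohlmannTheorem31All ↔
      ∀ (F : CMField), IsGalois ℚ F → ∀ (n : ℕ) (Θ : Fin (n + 1) → CMType F), Nontrivial (U.Coh (U.cmProd F Θ) 0) := by
  refine ⟨fun h F hG n Θ => ?_, fun h => ?_⟩
  · haveI := hG
    exact nontrivial_coh_zero_of_pohlmannTheorem31All hN4 h F Θ
  refine pohlmannTheorem31All_of_connectedGalois M hN1 hN2 hN3 hN4 fun F hG n Θ => ?_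
  haveI := h F hG n Θ
  exact le_antisymm (finrank_coh_zero_cmProd_le_one_of_descent M hN1 hN3 hd h7d) Module.finrank_pos

/-- Over the run-24/25 list the degree-`0` residual `CMProdH0Nontrivial` (qw8b-g3) implies `CMProdConnectedGalois`. -/
theorem cmProdConnectedGalois_of_h0Nontrivial_of_descent (M : U.ModelAxioms) (hN1 : U.Fact_cupExterior)
    (hN3 : U.Fact_pull_H0) (hd : U.Fact_dimProd) (h7d : U.Fact_gysinDescent) (hnt : U.CMProdH0Nontrivial) :
    U.CMProdConnectedGalois :=
  cmProdConnectedGalois_of_connected (cmProdConnected_of_descent M hN1 hN3 hd h7d hnt)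

/-- F-H0 `Fact_unitH0` (qw8-g4) gives `CMProdConnectedGalois` (through qw8b-g3 `cmProdConnected_of_unitH0`). -/
theorem cmProdConnectedGalois_of_unitH0 (M : U.ModelAxioms) (hu : U.Fact_unitH0) : U.CMProdConnectedGalois :=
  cmProdConnectedGalois_of_connected (cmProdConnected_of_unitH0 M hu)

end Universe

namespace Toy

/-- **`CMProdConnectedGalois` is independent of the trace-free generic list** `ModelAxioms` + N1–N4 + F4 + F5 + F7d +
`Fact_dimProd`: pohl-g7's witness universe (`degreeZero_independent`) satisfies the whole list and has `H⁰(X) = 0` for every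
`X`, so `dim_ℚ H⁰(A_Φ, ℚ) = 0 ≠ 1` for the Galois CM field `ℚ(ζ₇)` (`cyclo7`, `Model/Inhabited`).  Read through
`Universe.pohlmannTheorem31All_iff` this is pohl-g7's `pohlmannTheorem31All_not_derivable`. -/
theorem cmProdConnectedGalois_independent :
    ∃ U : Universe, (U.ModelAxioms ∧ U.Fact_cupExterior ∧ U.Fact_cup_hodge ∧ U.Fact_pull_H0 ∧ U.Fact_hodge_F0 ∧
      U.Fact_cupAlg ∧ U.Fact_cupAssoc ∧ U.Fact_gysinDescent ∧ U.Fact_dimProd) ∧ ¬ U.CMProdConnectedGalois := by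
  obtain ⟨U, hfacts, h0, -, -⟩ := degreeZero_independent
  refine ⟨U, hfacts, fun hc => ?_⟩
  have h1 := hc cyclo7 cyclo7_isGalois 0 (fun _ => stdCMType cyclo7)
  rw [h0] at h1
  exact zero_ne_one h1

/-- Pointwise form: no proof of `CMProdConnectedGalois` from the trace-free generic list exists. -/
theorem cmProdConnectedGalois_not_derivable :
    ¬ ∀ U : Universe, U.ModelAxioms → U.Fact_cupExterior → U.Fact_cup_hodge → U.Fact_pull_H0 → U.Fact_hodge_F0 →
      U.Fact_cupAlg → U.Fact_cupAssoc → U.Fact_gysinDescent → U.Fact_dimProd → U.CMProdConnectedGalois := by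
  intro h
  obtain ⟨U, ⟨M, hN1, hN2, hN3, hN4, h4, h5, h7d, hd⟩, hneg⟩ := cmProdConnectedGalois_independent
  exact hneg (h U M hN1 hN2 hN3 hN4 h4 h5 h7d hd)

end Toy

end HodgeCM

end
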